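import Literature.MathematicalPhysics.QuantumFieldTheory.Balaban1983to89.T4SmallFieldWindowSandwich
import Literature.MathematicalPhysics.QuantumFieldTheory.Balaban1983to89.B15Prop1ChartSU2

/-!
# DAG node N12 — junction (J-c): THE SMALL-FIELD AXIAL GAUGE OF THE BACKGROUND — producer of the `A₀`-letter («near-flat
# background in a chart about 1») that the (1.7)-at-flat-background road's (S5) ∕ U2c⁺ display, from the torus non-abelian
# Poincaré lemma of `T4AxialGaugeSmallField` and the `SU(2)` chart letters of `B15Prop1ChartSU2`

Cell `pub-ymgap`, YM-PLAN Track A (HUMAN RULING D-0062 ∕ D-0149), width seat `pub-ymgap-dag-n13-w2` (g0) RE-POINTED by the dag-lead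
desk (DEDUP-367 (2), DEDUP-368 (2)) to dag-n12-c g16's NAMED JUNCTION (J-c) (INBOX l.≈26361); route `BalabanUVNodes`, item K1⁷
`StabilityBAtRecordR13SepCoPH` = stmt-QuantumFields-20542 (helper lane, `--supports`, count-neutral).

THE PRINT.  [Balaban1989LargeFieldII] p. 357: *"At first, we apply the construction of Sect. F [15] to the configuration U₀, and
doing a proper gauge transformation we represent it on the domain Z as exp iξA₀, with A₀ satisfying the bound |A₀|, |∇A₀| <
O(1)M⁶R_kε_k"*; [Balaban1989LargeFieldI] p. 194 (Prop. 1's gauge invariance on `Λ`); [Balaban1985PropagatorsII] = [15]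
Sect. F (the smooth small-field gauge).  WHAT IS USED OF IT: only the FIRST bound, `|A₀|` small, and only ON A BOX — the
configuration-level content of «plaquette-small ⟹ in a proper gauge the bond variables are `exp` of a small field».

WHAT THIS FILE PROVES (kernel-checked, zero `sorry`, theorems only, std axioms; BY NAME over pub-balaban's
`T4AxialGaugeSmallField.{axialGauge, boxBonds, boxPlaqs, castSite, dist1_gaugeAct_axialGauge_le_of_mem_boxBonds}`,
`T4SmallFieldWindowSandwich.plaqSmallOn_one` and n12-c's
`B15Prop1ChartSU2.{su2Chart, iexp_ilog, norm_ilog_le}` — nothing re-proved):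
§1 (any gauge group) `axialGauge_eq_one_off_box`, **`isGaugeOn_axialGauge`** — the axial gauge of a box is a gauge transformation
   DEFINED ON the image of the box (`B15Prop1Carrier.IsGaugeOn`, Prop. 1's «gauge transformations defined on Λ»);
   **`exists_isGaugeOn_dist1_le_of_plaqSmallOn`** — plaquettes `< δ` on the plaquettes of a non-wrapping box of `n + 1` sites
   per direction ⟹ ∃ a gauge transformation defined on the box with `|U^u(b) − 1| ≤ (d − 1)·n·δ` on every bond of the box.
§2 (`SU(2)`) `eq_expMul_ilog` (every configuration `W` IS `expMul su2Chart ((1∕i) log W) 1` — the chart is onto),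
   `norm_ilog_gaugeAct_axialGauge_le`, and the junction **`exists_isGaugeOn_expMul_of_plaqSmallOn`**: under the same box
   hypotheses `∃ u a₀, IsGaugeOn (box) u ∧ U^u = expMul su2Chart a₀ 1 ∧ ∀ b ∈ box bonds, ‖a₀ b‖ ≤ (π∕2)·(d − 1)·n·δ` —
   the `A₀`-letter `hA₀` of (S5) ∕ U2c⁺ in its «`expMul su2Chart a₀ 1` with `a₀` small» form, produced from plaquette smallness.
§3 `exists_isGaugeOn_expMul_one` — A6: the hypotheses are inhabited (the flat configuration, pub-balaban's
   `T4SmallFieldWindowSandwich.plaqSmallOn_one` BY NAME), and the junction fires there.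
HONEST SCOPE.  (a) The axial (tree) gauge gives the SUP bound `|A₀|` only — print's second bound `|∇A₀|` (smoothness of the
Sect.-F [15] gauge) is NOT produced here and is not claimed; consumers needing `|∇A₀|` must display it.  (b) Box only, non-wrapping
(`n < sitesPerDir`): nothing on the whole torus (gauge-invariant non-contractible holonomies), nothing on general domains `Z`
(print's `Z` is a union of big cubes; a box containing it is the intended use).  (c) Constant `(d − 1)·n` = the corner-rooted
tree of `T4AxialGaugeSmallField` (print: `O(1)M⁶R_k` for a cube of side `∼ MR_k` in `ε_k`-units — same shape, constants not
matched).  (d) `PlaqSmallOn` is strict (`<`), conclusions are `≤`.  (e) Count-neutral junction; N12 NOT discharged; nothing of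
Bałaban asserted beyond the quoted sentence's first bound in the stated model; one finite 𝕋⁴ programme at fixed ε; R4 closes the
conditional finite-𝕋⁴ rung `BalabanLadder.UV` only — nothing continuum ∕ OS ∕ mass gap ∕ Clay.
-/

noncomputable section

namespace Summit.QuantumFields.YangMills.Theorems.BalabanUVNodesN12SmallFieldAxialGaugeOfBackground

open Literature.MathematicalPhysics.QuantumFieldTheory.Balaban1983to89
open Literature.MathematicalPhysics.QuantumFieldTheory.Balaban1983to89.T4AxialGaugeSmallField
open Literature.MathematicalPhysics.QuantumFieldTheory.Balaban1983to89.T4SmallFieldWindowSandwich (plaqSmallOn_one)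
open Literature.MathematicalPhysics.QuantumFieldTheory.Balaban1983to89.B15Prop1ChartSU2
open Literature.MathematicalPhysics.QuantumFieldTheory.Balaban1983to89.B15Prop1Carrier (IsGaugeOn)
open Literature.MathematicalPhysics.QuantumFieldTheory.Balaban1983to89.B16Sect1Backgrounds (expMul)
open Literature.MathematicalPhysics.QuantumFieldTheory.Balaban1983to89.T4CubeChartGnomonic (SU2)

variable {P : Params} {j : ℕ}

/-! ## §1  Any gauge group: the axial gauge of a box is defined on the box; bond variables `(d−1)·n·δ`-close to `1` -/

section AnyGroup

variable {G : Type*} [GaugeGroup G]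

/-- Off the image of the box the axial gauge transformation is `1` (its definition). [cite: Balaban1989LargeFieldI, (1.77) p.194 («gauge transformations defined on Λ»)] -/
theorem axialGauge_eq_one_off_box (U : GaugeField P j G) (lo hi : Fin P.d → ℤ) {s : Site P j}
    (hs : ¬ ∃ x : Fin P.d → ℤ, lo ≤ x ∧ x ≤ hi ∧ (castSite x : Site P j) = s) : axialGauge U lo hi s = 1 := by
  unfold axialGauge
  rw [dif_neg hs]

/-- **THE AXIAL GAUGE IS DEFINED ON THE BOX**: `axialGauge U lo hi` is a gauge transformation defined on the image
`{castSite x | lo ≤ x ≤ hi}` of the box in the sense of Prop. 1 (`IsGaugeOn`: `= 1` off that set). [cite: Balaban1989LargeFieldI, (1.77) p.194] -/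
theorem isGaugeOn_axialGauge (U : GaugeField P j G) (lo hi : Fin P.d → ℤ) :
    IsGaugeOn {s : Site P j | ∃ x : Fin P.d → ℤ, lo ≤ x ∧ x ≤ hi ∧ (castSite x : Site P j) = s} (axialGauge U lo hi) :=
  fun _ hs => axialGauge_eq_one_off_box U lo hi hs

/-- **PLAQUETTE-SMALL ON A BOX ⟹ A GAUGE DEFINED ON THE BOX IN WHICH EVERY BOND IS CLOSE TO `1`** («doing a proper gauge
transformation we represent it on the domain Z as exp iξA₀, with A₀ satisfying the bound |A₀| < O(1)M⁶R_kε_k», p. 357 — group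
level): if `|U(∂p) − 1| < δ` on the plaquettes of a non-wrapping box `[lo, hi]` of `n + 1` sites per direction (`S₀ ⊇ boxPlaqs lo hi`,
`hi ≤ lo + n`, `n < sitesPerDir j`, `0 ≤ δ`), then there is a gauge transformation `u` DEFINED ON the box with
`|U^u(b) − 1| ≤ (d − 1)·n·δ` for every bond `b` of the box — `u :=` the corner-rooted axial gauge of `T4AxialGaugeSmallField`.
[cite: Balaban1989LargeFieldII, p.357 («represent it on the domain Z as exp iξA₀, with A₀ satisfying the bound |A₀| …»)] -/
theorem exists_isGaugeOn_dist1_le_of_plaqSmallOn (U : GaugeField P j G) {lo hi : Fin P.d → ℤ} {δ : ℝ}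
    {S₀ : Set (Plaq P j)} {n : ℕ} (hS₀ : boxPlaqs lo hi ⊆ S₀) (hU : PlaqSmallOn S₀ δ U) (hδ : 0 ≤ δ)
    (hn : ∀ κ, hi κ ≤ lo κ + n) (hnN : n < P.sitesPerDir j) :
    ∃ u : GaugeTransf P j G,
      IsGaugeOn {s : Site P j | ∃ x : Fin P.d → ℤ, lo ≤ x ∧ x ≤ hi ∧ (castSite x : Site P j) = s} u ∧
      ∀ b ∈ boxBonds lo hi, dist1 (GaugeField.gaugeAct u U b) ≤ ((P.d - 1 : ℕ) : ℝ) * n * δ :=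
  ⟨axialGauge U lo hi, isGaugeOn_axialGauge U lo hi,
    fun _ hb => dist1_gaugeAct_axialGauge_le_of_mem_boxBonds U hS₀ hU hδ hn hnN hb⟩

end AnyGroup

/-! ## §2  `SU(2)`: the chart form — `U^u = expMul su2Chart a₀ 1` with `a₀` small on the box -/

section SUTwo

/-- **EVERY `SU(2)` CONFIGURATION IS `exp i(A)·1` FOR `A = (1∕i) log` OF IT** (the chart of `B15Prop1ChartSU2` is onto:
`iexp_ilog`): `W = expMul su2Chart (fun b => (1∕i) log W(b)) 1`. [cite: Balaban1989LargeFieldII, p.359 («we can write V′ = exp iB′»)] -/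
theorem eq_expMul_ilog (W : GaugeField P j SU2) : W = expMul su2Chart (fun b => su2Chart.ilog (W b)) 1 := by
  funext b
  show W b = su2Chart.iexp (su2Chart.ilog (W b)) * (1 : GaugeField P j SU2) b
  rw [iexp_ilog]
  exact (mul_one _).symm

/-- **THE `A₀`-LETTER'S NORM**: in the axial gauge of a plaquette-small non-wrapping box, `‖(1∕i) log U^u(b)‖ ≤ (π∕2)·(d − 1)·n·δ`
on every bond of the box (`norm_ilog_le`: `‖(1∕i) log g‖ ≤ (π∕2)|g − 1|`, then §1). [cite: Balaban1989LargeFieldII, p.357 («A₀ satisfying the bound |A₀| < …»), p.360 («|B| < g_k⁻¹δ′_k»)] -/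
theorem norm_ilog_gaugeAct_axialGauge_le (U : GaugeField P j SU2) {lo hi : Fin P.d → ℤ} {δ : ℝ}
    {S₀ : Set (Plaq P j)} {n : ℕ} (hS₀ : boxPlaqs lo hi ⊆ S₀) (hU : PlaqSmallOn S₀ δ U) (hδ : 0 ≤ δ)
    (hn : ∀ κ, hi κ ≤ lo κ + n) (hnN : n < P.sitesPerDir j) {b : PBond P j} (hb : b ∈ boxBonds lo hi) :
    ‖su2Chart.ilog (GaugeField.gaugeAct (axialGauge U lo hi) U b)‖ ≤ Real.pi / 2 * (((P.d - 1 : ℕ) : ℝ) * n * δ) :=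
  (norm_ilog_le _).trans
    (mul_le_mul_of_nonneg_left (dist1_gaugeAct_axialGauge_le_of_mem_boxBonds U hS₀ hU hδ hn hnN hb)
      (by positivity))

/-- **(J-c) THE SMALL-FIELD AXIAL GAUGE OF THE BACKGROUND, CHART FORM** — the producer of the `A₀`-letter of the
(1.7)-at-flat-background road: if `|U(∂p) − 1| < δ` on the plaquettes of a non-wrapping box `[lo, hi]` of `n + 1` sites per direction,
then there are a gauge transformation `u` DEFINED ON the box and a field `a₀` with `U^u = expMul su2Chart a₀ 1` (bondwise
`U^u(b) = exp i(a₀ b)`), `‖a₀ b‖ ≤ (π∕2)·(d − 1)·n·δ` AND `|U^u(b) − 1| ≤ (d − 1)·n·δ` on every bond of the box — p. 357's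
«represent it … as exp iξA₀, with A₀ satisfying the bound |A₀| < O(1)M⁶R_kε_k» at the configuration level, box version, sup
bound only (`u :=` the axial gauge, `a₀ := (1∕i) log U^u`). [cite: Balaban1989LargeFieldII, p.357] -/
theorem exists_isGaugeOn_expMul_of_plaqSmallOn (U : GaugeField P j SU2) {lo hi : Fin P.d → ℤ} {δ : ℝ}
    {S₀ : Set (Plaq P j)} {n : ℕ} (hS₀ : boxPlaqs lo hi ⊆ S₀) (hU : PlaqSmallOn S₀ δ U) (hδ : 0 ≤ δ)
    (hn : ∀ κ, hi κ ≤ lo κ + n) (hnN : n < P.sitesPerDir j) :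
    ∃ (u : GaugeTransf P j SU2) (a₀ : VecField P j (EuclideanSpace ℝ (Fin 3))),
      IsGaugeOn {s : Site P j | ∃ x : Fin P.d → ℤ, lo ≤ x ∧ x ≤ hi ∧ (castSite x : Site P j) = s} u ∧
      GaugeField.gaugeAct u U = expMul su2Chart a₀ 1 ∧
      (∀ b ∈ boxBonds lo hi, ‖a₀ b‖ ≤ Real.pi / 2 * (((P.d - 1 : ℕ) : ℝ) * n * δ)) ∧
      ∀ b ∈ boxBonds lo hi, dist1 (GaugeField.gaugeAct u U b) ≤ ((P.d - 1 : ℕ) : ℝ) * n * δ :=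
  ⟨axialGauge U lo hi, fun b => su2Chart.ilog (GaugeField.gaugeAct (axialGauge U lo hi) U b), isGaugeOn_axialGauge U lo hi,
    eq_expMul_ilog _, fun _ hb => norm_ilog_gaugeAct_axialGauge_le U hS₀ hU hδ hn hnN hb,
    fun _ hb => dist1_gaugeAct_axialGauge_le_of_mem_boxBonds U hS₀ hU hδ hn hnN hb⟩

end SUTwo

/-! ## §3  A6: the hypotheses are inhabited — the flat configuration -/

section Witness

variable {G : Type*} [GaugeGroup G]

/-- **The junction fires at the flat configuration** (A6): for any non-wrapping box and `δ > 0`, the hypotheses of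
`exists_isGaugeOn_expMul_of_plaqSmallOn` hold at `U ≡ 1`, hence its conclusion. [cite: Balaban1989LargeFieldII, p.357] -/
theorem exists_isGaugeOn_expMul_one {lo hi : Fin P.d → ℤ} {δ : ℝ} {n : ℕ} (hδ : 0 < δ) (hn : ∀ κ, hi κ ≤ lo κ + n)
    (hnN : n < P.sitesPerDir j) :
    ∃ (u : GaugeTransf P j SU2) (a₀ : VecField P j (EuclideanSpace ℝ (Fin 3))),
      IsGaugeOn {s : Site P j | ∃ x : Fin P.d → ℤ, lo ≤ x ∧ x ≤ hi ∧ (castSite x : Site P j) = s} u ∧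
      GaugeField.gaugeAct u (1 : GaugeField P j SU2) = expMul su2Chart a₀ 1 ∧
      (∀ b ∈ boxBonds lo hi, ‖a₀ b‖ ≤ Real.pi / 2 * (((P.d - 1 : ℕ) : ℝ) * n * δ)) ∧
      ∀ b ∈ boxBonds lo hi, dist1 (GaugeField.gaugeAct u (1 : GaugeField P j SU2) b) ≤ ((P.d - 1 : ℕ) : ℝ) * n * δ :=
  exists_isGaugeOn_expMul_of_plaqSmallOn 1 (Set.Subset.refl _) (plaqSmallOn_one _ hδ) hδ.le hn hnN

end Witness

end Summit.QuantumFields.YangMills.Theorems.BalabanUVNodesN12SmallFieldAxialGaugeOfBackground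

end
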